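import Summits.ValiantsHypothesis.ValiantsHypothesis.Theses.RealTau
import Literature.Computability.AlgebraicComplexity.ValiantConjectureEquivProofs

/-!
# ValiantsHypothesis / RealTau — items `Assembly` (stmt-ValiantsHypothesis-18108) and `OfKoiran`
# (stmt-ValiantsHypothesis-18105), closed

* `Assembly`: `VnSparseHard → RealVnTransfer → ValiantsHypothesis` — if `VP ℂ = VNP ℂ` then the
  permanent is p-computable (`perNotPComputableComplex_iff_holds`), so `RealVnTransfer` gives, for
  one exponent `C` and EVERY `n`, a sparse `ΣΠ` expression of Tavenas size for `V_n` over `ℝ`, while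
  `VnSparseHard` gives, for that `C`, an `n` admitting none. Pure logic.
* `OfKoiran`: Koiran's real `τ`-conjecture form `TauReal` (`≤ (k+m+t+2)^c` real zeros) implies
  Tavenas' refined form `RealTauRefined` (`≤ 2^{a(m+1)} (k+t+2)^a`): take `a = c` and use
  `k+m+t+2 ≤ 2^m (k+t+2)`. ℕ-arithmetic.
HONEST FRAMING: bookkeeping; the hypotheses are OPEN conjectures; nothing here is progress on
`VP ≠ VNP`.
-/

-- layout Summits/ValiantsHypothesis/ValiantsHypothesis forces the duplicated namespace component
set_option linter.dupNamespace false

namespace Summit.ValiantsHypothesis.ValiantsHypothesis.Theorems.RealTau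

/-- **Item `Assembly` (stmt-ValiantsHypothesis-18108):** `VnSparseHard → RealVnTransfer →
ValiantsHypothesis`. [folklore] -/
theorem assembly_proof : Theses.RealTau.Assembly := by
  unfold Theses.RealTau.Assembly Theses.RealTau.VnSparseHard Theses.RealTau.RealVnTransfer
  intro hHard hTransfer
  show Literature.Computability.AlgebraicComplexity.VP ℂ ≠
    Literature.Computability.AlgebraicComplexity.VNP ℂ
  rw [← Literature.Computability.AlgebraicComplexity.perNotPComputableComplex_iff_holds]
  intro hP
  obtain ⟨C, hC⟩ := hTransfer hP
  obtain ⟨n, -, hn⟩ := hHard C 0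
  obtain ⟨k, m, t, g, hk, hm, ht, hg, hsum⟩ := hC n
  exact hn k m t g hk hm ht hg hsum

/-- Arithmetic: `k + m + t + 2 ≤ 2 ^ m * (k + t + 2)`. [folklore] -/
private theorem add_le_two_pow_mul (k m t : ℕ) : k + m + t + 2 ≤ 2 ^ m * (k + t + 2) := by
  have h1 : m + 1 ≤ 2 ^ m := Nat.lt_two_pow_self
  have h2 : k + m + t + 2 ≤ (m + 1) * (k + t + 2) := by nlinarith
  exact h2.trans (Nat.mul_le_mul_right _ h1)

/-- **Item `OfKoiran` (stmt-ValiantsHypothesis-18105):** `TauReal → RealTauRefined` with `a = c`,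
since `(k+m+t+2)^c ≤ (2^m (k+t+2))^c ≤ 2^{c(m+1)} (k+t+2)^c`. [folklore] -/
theorem ofKoiran_proof : Theses.RealTau.OfKoiran := by
  unfold Theses.RealTau.OfKoiran Theses.RealTau.TauReal Theses.RealTau.RealTauRefined
  rintro ⟨c, hc⟩
  refine ⟨c, fun k m t f hf hne => (hc k m t f hf hne).trans ?_⟩
  calc (k + m + t + 2) ^ c ≤ (2 ^ m * (k + t + 2)) ^ c := Nat.pow_le_pow_left (add_le_two_pow_mul k m t) c
    _ = 2 ^ (c * m) * (k + t + 2) ^ c := by rw [mul_pow, ← pow_mul, mul_comm m c]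
    _ ≤ 2 ^ (c * (m + 1)) * (k + t + 2) ^ c :=
        Nat.mul_le_mul_right _ (Nat.pow_le_pow_right (by norm_num) (by nlinarith))

end Summit.ValiantsHypothesis.ValiantsHypothesis.Theorems.RealTau
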